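import Literature.Geometry.Lorentzian.SchwarzschildIsotropicMap
import Literature.Geometry.Lorentzian.ExactKerrEnd
import HarnessLib

/-!
# The time-symmetric Schwarzschild exterior is an exact Kerr leaf (isotropic coordinates)

Support file (all results proved; the definitions are explicit closed-form expressions, no
named facts), part 2 of 2 (continuing `SchwarzschildIsotropicMap.lean`). Composing the isotropic
radial map `isoMap M z = (1 + M/2ρ)² z` (`ρ = ‖z‖ > M/2`) with the static leaf
`Φ(x) = (2M log(r − 2M), x)` of the ingoing Kerr–Schild chart of Schwarzschild gives the
**isotropic leaf** `Schwarzschild.kerrLeaf M U hU hM : U → Kerr.region 0 (2M)` over any open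
`U ⊆ {ρ > M/2}` (`0 ≤ M`). We prove:

* `bilin_mfderiv_kerrLeaf` — its induced metric is `(1 + M/2ρ)⁴ δ`, the metric of
  `Schwarzschild.conformalData U` / `Schwarzschild.timeSymmetricExteriorData` (`ModelData.lean`);
* it is `C^∞`, injective, a spacelike immersion, with future unit normal the normalised static
  Killing field `(1 − 2M/r)^{-1/2}∂_{t*}` (`isFutureUnitNormal_kerrNormal`), and **totally geodesic**
  (`secondFundamentalForm_kerrLeaf`, from `Kerr.bilin_secondFundamentalFormRep_eq_zero`);
* **`isExactKerrEndAlong_conformalData`, `hasExactKerrEnd_conformalData`** and the special cases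
  **`isExactKerrEndAlong_timeSymmetricExteriorData`, `hasExactKerrEnd_timeSymmetricExteriorData`**:
  the conformally flat Schwarzschild data `(U, (1 + M/2ρ)⁴ δ, 0)`, `U ⊆ {ρ > M/2}` open, are an
  exact spacelike Kerr leaf everywhere (`K = ∅`, `φ = id`), in particular Kerr-ended
  (`InitialDataSet.HasExactKerrEnd`, `ExactKerrEnd.lean`). Unlike the Kerr–Schild slices `Kerr.data`
  (`Kerr.hasExactKerrEnd_data`; not Dafermos–Rodnianski flat, `Kerr.not_isStronglyAsymptoticallyFlatDR_data`)
  these data have the admissible asymptotics `h − (1 + 2M/ρ)δ = O₂(ρ⁻²)`, `k = 0`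
  (`SchwarzschildIsotropicAsymptotics.lean`).

References: Misner–Thorne–Wheeler 1973, (31.22); Wald 1984, §6.4 and §10.2 (time-symmetric data);
O'Neill 1983, Ch. 4 (induced metric, shape tensor); Corvino–Schoen, J. Differential Geom. 73
(2006), §1 (data exactly Schwarzschild/Kerr outside a compact set); Bray, J. Differential Geom. 59
(2001), §1.
-/

noncomputable section

-- instance search through the nested operator types `E4 →L E4 →L E4 →L ℝ` (as in `ChartCurvature`)
set_option maxSynthPendingDepth 3

open Bundle TopologicalSpace Manifold Set Module
open scoped ContDiff Topology InnerProductSpace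

namespace Literature.Geometry.Lorentzian

namespace Schwarzschild

/-! ### The isotropic leaf over an open set of the isotropic exterior -/

variable {M : ℝ} {U : Opens E3}

/-- Points of an open `U ⊆ {‖z‖ > M/2}` are nonzero when `0 ≤ M`. [cite: Bray2001, §1] -/
theorem ne_zero_of_mem_of_half_lt (hU : ∀ z ∈ U, M / 2 < ‖z‖) (hM : 0 ≤ M) (z : U) : (z : E3) ≠ 0 := by
  intro h0
  have hz := hU z z.2
  rw [h0, norm_zero] at hz
  linarith

/-- `‖z‖ > M/2` on `U ⊆ {‖z‖ > M/2}` (subtype form). [cite: Bray2001, §1] -/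
theorem half_lt_norm_of_mem (hU : ∀ z ∈ U, M / 2 < ‖z‖) (z : U) : M / 2 < ‖(z : E3)‖ :=
  hU z z.2

/-- The isotropic exterior `{‖z‖ > M/2}` itself qualifies. [cite: Bray2001, §1] -/
theorem half_lt_norm_of_mem_isotropicExterior (M : ℝ) :
    ∀ z ∈ isotropicExterior M, M / 2 < ‖z‖ := fun _ hz ↦ mem_isotropicExterior.1 hz

/-- An open `U ⊆ {‖z‖ > M/2}` misses the origin when `0 ≤ M`. [cite: Bray2001, §1] -/
theorem zero_notMem_of_half_lt (hU : ∀ z ∈ U, M / 2 < ‖z‖) (hM : 0 ≤ M) : (0 : E3) ∉ (U : Set E3) :=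
  fun h0 ↦ ne_zero_of_mem_of_half_lt hU hM ⟨0, h0⟩ rfl

variable (M U) in
/-- **The isotropic leaf** over an open set `U ⊆ {‖z‖ > M/2}` of the isotropic exterior: `U`
mapped onto the static slice `{t = 0}` of the Schwarzschild Kerr–Schild chart,
`z ↦ (T(r), (1 + M/2ρ)² z)`, `r = ρ(1 + M/2ρ)²`, `T(r) = 2M log(r − 2M)` — the composite of the
isotropic radial map with the static leaf. Its image lies in `{r > 2M}` (`two_mul_lt_norm_isoMap`).
MTW 1973, (31.22); Wald 1984, §6.4. [cite: MTW1973, (31.22)] -/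
def kerrLeaf (hU : ∀ z ∈ U, M / 2 < ‖z‖) (hM : 0 ≤ M) : U → Kerr.region 0 (2 * M) :=
  fun z ↦ ⟨Kerr.staticLeafRep M (isoMap M z), by
    rw [Kerr.mem_region, Kerr.radius_zero_eq_norm_spatial, Kerr.spatial_staticLeafRep,
      max_eq_left (by linarith : (0 : ℝ) ≤ 2 * M)]
    exact two_mul_lt_norm_isoMap M (half_lt_norm_of_mem hU z) (ne_zero_of_mem_of_half_lt hU hM z)⟩

/-- Unfolding lemma: `kerrLeaf z = Φ(isoMap z)`, `Φ` the static leaf representative. [cite: MTW1973, (31.22)] -/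
@[simp]
theorem coe_kerrLeaf (hU : ∀ z ∈ U, M / 2 < ‖z‖) (hM : 0 ≤ M) (z : U) :
    (kerrLeaf M U hU hM z : E4) = Kerr.staticLeafRep M (isoMap M z) := rfl

variable (M U) in
/-- The future unit normal of the isotropic leaf: the normalised static Killing field
`(1 − 2M/r)^{-1/2} ∂_{t*}` at the image point. Wald 1984, §10.2. [cite: Wald1984, §10.2] -/
def kerrNormal (hU : ∀ z ∈ U, M / 2 < ‖z‖) (hM : 0 ≤ M) : NormalField 𝓘(ℝ, E4) (kerrLeaf M U hU hM) :=
  fun z ↦ Kerr.staticNormalRep M (isoMap M z)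

/-- Unfolding lemma for `kerrNormal`. [cite: Wald1984, §10.2] -/
theorem kerrNormal_apply (hU : ∀ z ∈ U, M / 2 < ‖z‖) (hM : 0 ≤ M) (z : U) :
    kerrNormal M U hU hM z = (Kerr.staticNormalRep M ∘ isoMap M) z := rfl

/-- The representative of the isotropic leaf is differentiable, with derivative
`DΦ(isoMap z) ∘ D(isoMap)(z)`, at the points `‖z‖ > M/2` (`0 ≤ M`). [cite: MTW1973, (31.22)] -/
theorem hasFDerivAt_kerrLeafRep (hM : 0 ≤ M) {z : E3} (hz : M / 2 < ‖z‖) (hz0 : z ≠ 0) :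
    HasFDerivAt (Kerr.staticLeafRep M ∘ isoMap M)
      ((Kerr.staticLeafDeriv M (isoMap M z)).comp (isoDeriv M z)) z :=
  (Kerr.hasFDerivAt_staticLeafRep M (two_mul_lt_norm_isoMap M hz hz0) (isoMap_ne_zero hM hz0)).comp z
    (hasFDerivAt_isoMap M hz0)

/-- The representative of the isotropic leaf is `C^∞` at the points `‖z‖ > M/2` (`0 ≤ M`).
[cite: MTW1973, (31.22)] -/
theorem contDiffAt_kerrLeafRep (hM : 0 ≤ M) {z : E3} (hz : M / 2 < ‖z‖) (hz0 : z ≠ 0)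
    {n : WithTop ℕ∞} : ContDiffAt ℝ n (Kerr.staticLeafRep M ∘ isoMap M) z :=
  (Kerr.contDiffAt_staticLeafRep M (two_mul_lt_norm_isoMap M hz hz0) (isoMap_ne_zero hM hz0)).comp z
    (contDiffAt_isoMap M hz0)

/-- **The isotropic leaf is `C^∞`.** [cite: MTW1973, (31.22)] -/
theorem contMDiff_kerrLeaf (hU : ∀ z ∈ U, M / 2 < ‖z‖) (hM : 0 ≤ M) :
    ContMDiff 𝓘(ℝ, E3) 𝓘(ℝ, E4) ∞ (kerrLeaf M U hU hM) := by
  intro z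
  have h1 : ContMDiffAt 𝓘(ℝ, E3) 𝓘(ℝ, E4) ∞
      (fun z : U ↦ (Kerr.staticLeafRep M ∘ isoMap M) z) z :=
    (OpensChart.contMDiffAt_iff z _ (Kerr.staticLeafRep M ∘ isoMap M) (fun _ ↦ rfl)).2
      (contDiffAt_kerrLeafRep hM (half_lt_norm_of_mem hU z)
        (ne_zero_of_mem_of_half_lt hU hM z))
  exact (ChartedSpace.liftPropWithinAt_subtypeVal_comp_iff (kerrLeaf M U hU hM) Set.univ z).mp h1

/-- **The differential of the isotropic leaf**: `d(kerrLeaf)_z = DΦ(isoMap z) ∘ D(isoMap)(z)`.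
[cite: MTW1973, (31.22)] -/
theorem hasMFDerivAt_kerrLeaf (hU : ∀ z ∈ U, M / 2 < ‖z‖) (hM : 0 ≤ M) (z : U) :
    HasMFDerivAt 𝓘(ℝ, E3) 𝓘(ℝ, E4) (kerrLeaf M U hU hM) z
      ((Kerr.staticLeafDeriv M (isoMap M z)).comp (isoDeriv M z)) := by
  have hΦ := hasFDerivAt_kerrLeafRep hM (half_lt_norm_of_mem hU z)
    (ne_zero_of_mem_of_half_lt hU hM z)
  have h1 : HasMFDerivAt 𝓘(ℝ, E3) 𝓘(ℝ, E4)
      (fun z : U ↦ (Kerr.staticLeafRep M ∘ isoMap M) z) z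
      ((Kerr.staticLeafDeriv M (isoMap M z)).comp (isoDeriv M z)) := by
    have hmd : MDifferentiableAt 𝓘(ℝ, E3) 𝓘(ℝ, E4)
        (fun z : U ↦ (Kerr.staticLeafRep M ∘ isoMap M) z) z :=
      (OpensChart.mdifferentiableAt_iff z _ (Kerr.staticLeafRep M ∘ isoMap M) (fun _ ↦ rfl)).2
        hΦ.differentiableAt
    have := hmd.hasMFDerivAt
    rwa [OpensChart.mfderiv_eq z _ (Kerr.staticLeafRep M ∘ isoMap M) (fun _ ↦ rfl)
      hΦ.differentiableAt, hΦ.fderiv] at this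
  exact OpensChart.hasMFDerivAt_codRestrict (fun _ ↦ rfl) h1

/-- `mfderiv` form: `d(kerrLeaf)_z v = DΦ(isoMap z) (D(isoMap)(z) v)`. [cite: MTW1973, (31.22)] -/
theorem mfderiv_kerrLeaf_apply (hU : ∀ z ∈ U, M / 2 < ‖z‖) (hM : 0 ≤ M) (z : U) (v : E3) :
    mfderiv 𝓘(ℝ, E3) 𝓘(ℝ, E4) (kerrLeaf M U hU hM) z v =
      Kerr.staticLeafDeriv M (isoMap M z) (isoDeriv M z v) := by
  rw [(hasMFDerivAt_kerrLeaf hU hM z).mfderiv]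
  rfl

/-- **The isotropic leaf is injective** (the isotropic map is injective on the exterior and the
static leaf over it is a graph). [cite: MTW1973, (31.22)] -/
theorem kerrLeaf_injective (hU : ∀ z ∈ U, M / 2 < ‖z‖) (hM : 0 ≤ M) : Function.Injective (kerrLeaf M U hU hM) := by
  intro z z' h
  have h' := congrArg (fun x : Kerr.region 0 (2 * M) ↦ E4.spatial (x : E4)) h
  simp only [coe_kerrLeaf, Kerr.spatial_staticLeafRep] at h'
  exact Subtype.ext (isoMap_injOn hM (half_lt_norm_of_mem hU z)
    (half_lt_norm_of_mem hU z') h')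

/-- **The induced metric of the isotropic leaf is the conformally flat Schwarzschild metric**:
`g(d(kerrLeaf) v, d(kerrLeaf) w) = (1 + M/2ρ)⁴ ⟪v, w⟫`. MTW 1973, (31.22). [cite: MTW1973, (31.22)] -/
theorem bilin_mfderiv_kerrLeaf (hU : ∀ z ∈ U, M / 2 < ‖z‖) (hM : 0 ≤ M) (z : U) (v w : E3) :
    Kerr.bilin M 0 (kerrLeaf M U hU hM z : E4) (mfderiv 𝓘(ℝ, E3) 𝓘(ℝ, E4) (kerrLeaf M U hU hM) z v)
        (mfderiv 𝓘(ℝ, E3) 𝓘(ℝ, E4) (kerrLeaf M U hU hM) z w) =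
      conformalFactor M (z : E3) ^ 4 * ⟪v, w⟫_ℝ := by
  have hz := half_lt_norm_of_mem hU z
  have hz0 := ne_zero_of_mem_of_half_lt hU hM z
  rw [mfderiv_kerrLeaf_apply, mfderiv_kerrLeaf_apply, coe_kerrLeaf,
    Kerr.bilin_staticLeafDeriv M (two_mul_lt_norm_isoMap M hz hz0) (isoMap_ne_zero hM hz0),
    staticHRep_isoDeriv hM hz hz0]

/-- **The isotropic leaf is a spacelike immersion** into the Schwarzschild Kerr–Schild chart
`(Kerr.region 0 (2M), g_{M,0})`. O'Neill 1983, Ch. 4, p. 97. [cite: ONeill1983, Ch. 4, p. 97] -/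
theorem isSpacelikeImmersion_kerrLeaf [Kerr.Facts] (hU : ∀ z ∈ U, M / 2 < ‖z‖) (hM : 0 ≤ M) :
    (Kerr.smoothMetric M 0 (2 * M)).IsSpacelikeImmersion 𝓘(ℝ, E3) (kerrLeaf M U hU hM) := by
  refine ⟨contMDiff_kerrLeaf hU hM, fun z v hv ↦ ?_⟩
  set w : E3 := v with hw
  have hw0 : w ≠ 0 := hv
  have hgoal : 0 < Kerr.bilin M 0 (kerrLeaf M U hU hM z : E4)
      (mfderiv 𝓘(ℝ, E3) 𝓘(ℝ, E4) (kerrLeaf M U hU hM) z w)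
      (mfderiv 𝓘(ℝ, E3) 𝓘(ℝ, E4) (kerrLeaf M U hU hM) z w) := by
    rw [bilin_mfderiv_kerrLeaf hU hM z w w]
    exact mul_pos (pow_pos (conformalFactor_pos hM _) 4) (real_inner_self_pos.2 hw0)
  rw [PseudoRiemannianMetric.inducedBilin_apply, Kerr.smoothMetric_val]
  exact hgoal

/-- **The normalised static Killing field is the future unit normal of the isotropic leaf** for
the Kerr time orientation. Wald 1984, §10.2. [cite: Wald1984, §10.2] -/
theorem isFutureUnitNormal_kerrNormal [Kerr.Facts] (hU : ∀ z ∈ U, M / 2 < ‖z‖) (hM : 0 ≤ M) :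
    (Kerr.smoothMetric M 0 (2 * M)).IsFutureUnitNormal 𝓘(ℝ, E3)
      ((Kerr.timeOrientation M 0 (2 * M) hM).ofLE le_top) (kerrLeaf M U hU hM) (kerrNormal M U hU hM) := by
  refine ⟨⟨fun z v ↦ ?_, fun z ↦ ?_⟩, fun z ↦ ⟨⟨?_, ?_⟩, ?_⟩⟩
  · have hz := half_lt_norm_of_mem hU z
    have hz0 := ne_zero_of_mem_of_half_lt hU hM z
    set w : E3 := v with hw
    have hgoal : Kerr.bilin M 0 (kerrLeaf M U hU hM z : E4) (kerrNormal M U hU hM z)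
        (mfderiv 𝓘(ℝ, E3) 𝓘(ℝ, E4) (kerrLeaf M U hU hM) z w) = 0 := by
      rw [mfderiv_kerrLeaf_apply, coe_kerrLeaf]
      exact Kerr.bilin_staticNormalRep_staticLeafDeriv M (two_mul_lt_norm_isoMap M hz hz0)
        (isoMap_ne_zero hM hz0) _
    rw [Kerr.smoothMetric_val]
    exact hgoal
  · have hgoal : Kerr.bilin M 0 (kerrLeaf M U hU hM z : E4) (kerrNormal M U hU hM z) (kerrNormal M U hU hM z) = -1 :=
      Kerr.bilin_staticNormalRep_self M
        (two_mul_lt_norm_isoMap M (half_lt_norm_of_mem hU z)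
          (ne_zero_of_mem_of_half_lt hU hM z))
        (isoMap_ne_zero hM (ne_zero_of_mem_of_half_lt hU hM z))
    rw [Kerr.smoothMetric_val]
    exact hgoal
  · have h1 : Kerr.bilin M 0 (kerrLeaf M U hU hM z : E4) (kerrNormal M U hU hM z) (kerrNormal M U hU hM z) = -1 :=
      Kerr.bilin_staticNormalRep_self M
        (two_mul_lt_norm_isoMap M (half_lt_norm_of_mem hU z)
          (ne_zero_of_mem_of_half_lt hU hM z))
        (isoMap_ne_zero hM (ne_zero_of_mem_of_half_lt hU hM z))
    have hgoal : Kerr.bilin M 0 (kerrLeaf M U hU hM z : E4) (kerrNormal M U hU hM z) (kerrNormal M U hU hM z) ≤ 0 := by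
      rw [h1]
      norm_num
    rw [Kerr.smoothMetric_val]
    exact hgoal
  · intro h0
    have h1 := Kerr.bilin_staticNormalRep_self M
      (two_mul_lt_norm_isoMap M (half_lt_norm_of_mem hU z)
        (ne_zero_of_mem_of_half_lt hU hM z))
      (isoMap_ne_zero hM (ne_zero_of_mem_of_half_lt hU hM z))
    rw [show Kerr.staticNormalRep M (isoMap M z) = (0 : E4) from h0] at h1
    simp at h1
  · have hgoal : Kerr.bilin M 0 (kerrLeaf M U hU hM z : E4)
        (Kerr.timeVector M 0 (kerrLeaf M U hU hM z : E4)) (kerrNormal M U hU hM z) < 0 :=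
      Kerr.bilin_timeVector_staticNormalRep_neg M
        (two_mul_lt_norm_isoMap M (half_lt_norm_of_mem hU z)
          (ne_zero_of_mem_of_half_lt hU hM z))
        (isoMap_ne_zero hM (ne_zero_of_mem_of_half_lt hU hM z))
    rw [TimeOrientation.vectorField_ofLE, Kerr.smoothMetric_val]
    exact hgoal

/-- **The isotropic leaf is totally geodesic: `K = 0`** — the time-symmetry of the
Schwarzschild `{t = 0}` slice, for the reparametrised leaf: by the coordinate formula
`K(v, w) = g(D(N ∘ isoMap) v + Γ(N)(D(Φ ∘ isoMap) v), D(Φ ∘ isoMap) w)` and the chain rule this is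
the representative expression of `Kerr.bilin_secondFundamentalFormRep_eq_zero` on the vectors
`D(isoMap) v`, `D(isoMap) w`. Wald 1984, §10.2; O'Neill 1983, Ch. 4, Lemma 4.4 ff.
[cite: Wald1984, §10.2] -/
theorem secondFundamentalForm_kerrLeaf [Kerr.Facts] [(Kerr.smoothMetric M 0 (2 * M)).HasLeviCivita]
    (hU : ∀ z ∈ U, M / 2 < ‖z‖) (hM : 0 ≤ M) (z : U) (v w : E3) :
    (Kerr.smoothMetric M 0 (2 * M)).secondFundamentalForm 𝓘(ℝ, E3) (kerrLeaf M U hU hM) (kerrNormal M U hU hM)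
      z v w = 0 := by
  have hz := half_lt_norm_of_mem hU z
  have hz0 := ne_zero_of_mem_of_half_lt hU hM z
  have hx := two_mul_lt_norm_isoMap M hz hz0
  have hx0 := isoMap_ne_zero hM hz0
  have hsp : E4.spatial (Kerr.staticLeafRep M (isoMap M z)) ≠ 0 := by
    rwa [Kerr.spatial_staticLeafRep]
  have hΦ := hasFDerivAt_kerrLeafRep hM hz hz0
  have hiso := hasFDerivAt_isoMap M hz0
  have hNd : DifferentiableAt ℝ (Kerr.staticNormalRep M) (isoMap M z) :=
    Kerr.differentiableAt_staticNormalRep M hx hx0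
  have hN : DifferentiableAt ℝ (Kerr.staticNormalRep M ∘ isoMap M) (z : E3) :=
    hNd.comp (z : E3) hiso.differentiableAt
  have hGd : DifferentiableAt ℝ (Kerr.bilin M 0) (kerrLeaf M U hU hM z : E4) :=
    (Kerr.hasFDerivAt_bilin_zero M hsp).differentiableAt
  rw [OpensChart.secondFundamentalForm_eq_of_repr
    (g := (Kerr.smoothMetric M 0 (2 * M)).toPseudoRiemannianMetric)
    (G := Kerr.bilin M 0) (Kerr.smoothMetric_val M 0 (2 * M)) (f := kerrLeaf M U hU hM)
    (Φ := Kerr.staticLeafRep M ∘ isoMap M) (coe_kerrLeaf hU hM) (kerrNormal_apply hU hM)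
    hΦ.differentiableAt hN hGd v w, hΦ.fderiv, fderiv_comp (z : E3) hNd hiso.differentiableAt,
    hiso.fderiv]
  exact Kerr.bilin_secondFundamentalFormRep_eq_zero (kerrLeaf M U hU hM z) (coe_kerrLeaf hU hM z) hx hx0
    (isoDeriv M z v) (isoDeriv M z w)

/-! ### The conformally flat Schwarzschild data are Kerr-ended -/

/-- **The conformally flat time-symmetric Schwarzschild data `(U, (1 + M/2ρ)⁴ δ, 0)` over any open
`U ⊆ {‖z‖ > M/2}` are, everywhere, an exact spacelike leaf of the Schwarzschild Kerr–Schild chart**: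
exact Kerr end data `(K, U, M, a, r₀, φ, ψ, ν) = (∅, U, M, 0, 2M, id, kerrLeaf, kerrNormal)` for
`Schwarzschild.conformalData U hM _` (`IsExactKerrEndAlong`, `ExactKerrEnd.lean`): induced metric
`ψ^* g = (1 + M/2ρ)⁴ δ = h` and second fundamental form `0 = k`. MTW 1973, (31.22); Wald 1984,
§6.4, §10.2; Corvino–Schoen 2006, §1 (data exactly Schwarzschild outside a compact set).
[cite: MTW1973, (31.22)] -/
theorem isExactKerrEndAlong_conformalData [Kerr.Facts] (hU : ∀ z ∈ U, M / 2 < ‖z‖) (hM : 0 ≤ M) :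
    (conformalData U hM (zero_notMem_of_half_lt hU hM)).IsExactKerrEndAlong ∅ U M 0 (2 * M) hM
      id (kerrLeaf M U hU hM) (kerrNormal M U hU hM) := by
  refine ⟨isCompact_empty, fun z _ ↦ ⟨z, rfl⟩, Topology.IsOpenEmbedding.id, contMDiff_id,
    kerrLeaf_injective hU hM, isSpacelikeImmersion_kerrLeaf hU hM, isFutureUnitNormal_kerrNormal hU hM,
    fun z v w _ ↦ ?_, fun z v w _ ↦ ?_⟩
  · rw [mfderiv_id]
    show conformalFactor M (z : E3) ^ 4 * ⟪v, w⟫_ℝ = _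
    exact (bilin_mfderiv_kerrLeaf hU hM z v w).symm
  · rw [secondFundamentalForm_kerrLeaf hU hM z v w]
    rfl

/-- **The conformally flat Schwarzschild data over an open `U ⊆ {‖z‖ > M/2}` are Kerr-ended**
(`HasExactKerrEnd` with empty exceptional set). MTW 1973, (31.22); Corvino–Schoen 2006, §1.
[cite: MTW1973, (31.22)] -/
theorem hasExactKerrEnd_conformalData (hU : ∀ z ∈ U, M / 2 < ‖z‖) (hM : 0 ≤ M) :
    (conformalData U hM (zero_notMem_of_half_lt hU hM)).HasExactKerrEnd := by
  intro _
  exact ⟨∅, U, M, 0, 2 * M, hM, id, kerrLeaf M U hU hM, kerrNormal M U hU hM,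
    isExactKerrEndAlong_conformalData hU hM⟩

/-- **The time-symmetric Schwarzschild exterior data `({‖z‖ > M/2}, (1 + M/2ρ)⁴ δ, 0)` are an
exact spacelike Kerr leaf everywhere** (`Schwarzschild.timeSymmetricExteriorData`, the case
`U = isotropicExterior M`). MTW 1973, (31.22); Corvino–Schoen 2006, §1. [cite: MTW1973, (31.22)] -/
theorem isExactKerrEndAlong_timeSymmetricExteriorData [Kerr.Facts] (hM : 0 ≤ M) :
    (timeSymmetricExteriorData M hM).IsExactKerrEndAlong ∅ (isotropicExterior M) M 0 (2 * M) hM id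
      (kerrLeaf M (isotropicExterior M) (half_lt_norm_of_mem_isotropicExterior M) hM)
      (kerrNormal M (isotropicExterior M) (half_lt_norm_of_mem_isotropicExterior M) hM) :=
  isExactKerrEndAlong_conformalData (half_lt_norm_of_mem_isotropicExterior M) hM

/-- **The time-symmetric Schwarzschild exterior data are Kerr-ended** — the first exact Kerr end in
the tree with Dafermos–Rodnianski-admissible (time-symmetric, conformally flat) asymptotics, as
opposed to the Kerr–Schild slices `Kerr.data` (`Kerr.hasExactKerrEnd_data`;
`Kerr.not_isStronglyAsymptoticallyFlatDR_data`). MTW 1973, (31.22); Corvino–Schoen 2006, §1.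
[cite: MTW1973, (31.22)] -/
theorem hasExactKerrEnd_timeSymmetricExteriorData (hM : 0 ≤ M) :
    (timeSymmetricExteriorData M hM).HasExactKerrEnd :=
  hasExactKerrEnd_conformalData (half_lt_norm_of_mem_isotropicExterior M) hM

end Schwarzschild

end Literature.Geometry.Lorentzian

end
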